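import Summits.Ventures.PercRepro.RankDistTightBiIndep
import Mathlib.Combinatorics.Enumerative.DoubleCounting

/-!
# PercRepro — THE SIZE LEVELS OF THE UP-SET OF THE BOTTOM SETS, THEIR BOOLEAN LYM INEQUALITY, AND THE
RANK LEVEL DOMINATES THE SIZE LEVEL BELOW `p/2` (p9, gen 20)

Let `𝓤 = {A ⊆ E : A ⊇ some bottom set}` be the up-set generated by `𝓑 = PerFlat.Uq M p q` and
`U_k = sizeLev M p q k = {A ∈ 𝓤 : |A| = k}` its SIZE levels (the rank levels `∂_u 𝓑 = shadowLev M u 𝓑` slice the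
same up-set by RANK). Two unconditional theorems:
* **Boolean LYM** (`card_sizeLev_mul_le`, `card_sizeLev_mul_choose_le`): `(n − k)·U_k ≤ (k + 1)·U_{k+1}`, hence
  `U_a·C(n, b) ≤ U_b·C(n, a)` for `a ≤ b` (every `A ∈ U_k` has `n − k` supersets in `U_{k+1}`, every
  `A' ∈ U_{k+1}` has `≤ k + 1` subsets in `U_k`).
* **THEOREM P** (`card_sizeLev_le_card_shadowLev`; tight layer `|E| = p + q`, `ρ(E) = p`): `U_u ≤ s_u` whenever
  `2u ≤ p`. Stratify by the NULLITY `ν`: `L_ν = {A ∈ 𝓤 : |A| = u, ρ(A) = u − ν}`, `R_ν = {A' ∈ 𝓤 : ρ(A') = u,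
  |A'| = u + ν}`; every `A ∈ L_ν` lies below `≥ C(p − u + ν, ν)` members of `R_ν` (add `ν` elements of a base
  through a basis of `A`, taken outside `A`), every `A' ∈ R_ν` above `≤ C(u + ν, ν)` members of `L_ν` (its
  `u`-subsets): `|L_ν|·C(p − u + ν, ν) ≤ |R_ν|·C(u + ν, ν)` (`Finset.card_mul_le_card_mul`), and
  `C(u + ν, ν) ≤ C(p − u + ν, ν)` for `2u ≤ p`.
Corollaries: `#𝓑·C(n, u) ≤ s_u·C(n, q)` for every `q ≤ u ≤ p/2` (`card_Uq_mul_choose_le_card_shadowLev_mul_choose`)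
and, with closed bottom sets (`d_q = 0`, e.g. every circuit has `≥ q + 2` elements), the row C-048 at those levels
(`shadowCumulative_below_half_of_closed`). The census (lean-drafts/p9/g20/research/t25.py, t26.py) shows
`U_u ≤ s_u` up to `2u ≤ n` and its FAILURE above the middle; nothing here moves any window of the crux.
-/

namespace PercRepro.RankDist

open Set Finset _root_.Matroid PercRepro.ThmH

variable {α : Type} [DecidableEq α] (M : Matroid α) [M.Finite]

/-! ## The size levels of the up-set of the bottom sets -/

open scoped Classical in
/-- `U_k`: the subsets of `E` with exactly `k` elements containing a bottom set of `(p, q)` — the size level `k`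
of the up-set generated by `PerFlat.Uq M p q`. -/
noncomputable def sizeLev (p q k : ℕ) : Finset (Set α) :=
  (subsetsFin M).filter (fun A => A.ncard = k ∧ ∃ B ∈ PerFlat.Uq M p q, (B : Set α) ⊆ A)

open scoped Classical in
/-- Membership in `sizeLev`. -/
lemma mem_sizeLev {p q k : ℕ} {A : Set α} :
    A ∈ sizeLev M p q k ↔ A ⊆ M.E ∧ A.ncard = k ∧ ∃ B ∈ PerFlat.Uq M p q, (B : Set α) ⊆ A := by
  unfold sizeLev
  rw [Finset.mem_filter, mem_subsetsFin]

omit [DecidableEq α] in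
/-- `x ∈ gr M ↔ x ∈ M.E`. -/
lemma mem_gr {x : α} : x ∈ gr M ↔ x ∈ M.E := by
  rw [← Finset.mem_coe, coe_gr]

/-- The bottom sets are the size level `q`. -/
theorem sizeLev_q_eq {p q : ℕ} (hn : (gr M).card = p + q) (hr : M.eRank = (p : ℕ∞)) :
    sizeLev M p q q = (PerFlat.Uq M p q).image (fun B : Finset α => (B : Set α)) := by
  ext A
  rw [mem_sizeLev, Finset.mem_image]
  constructor
  · rintro ⟨hAE, hAq, B, hB, hBA⟩
    refine ⟨B, hB, ?_⟩
    have hBq := ((mem_Uq_tight M hn hr).1 hB).2.2.1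
    have hfin : A.Finite := M.ground_finite.subset hAE
    refine Set.eq_of_subset_of_ncard_le hBA ?_ hfin
    rw [hAq, Set.ncard_coe_finset, hBq]
  · rintro ⟨B, hB, rfl⟩
    have hB' := (mem_Uq_tight M hn hr).1 hB
    refine ⟨hB'.2.1.subset_ground, ?_, B, hB, subset_rfl⟩
    rw [Set.ncard_coe_finset, hB'.2.2.1]

/-- `U_q = #𝓑`. -/
theorem card_sizeLev_q {p q : ℕ} (hn : (gr M).card = p + q) (hr : M.eRank = (p : ℕ∞)) :
    (sizeLev M p q q).card = (PerFlat.Uq M p q).card := by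
  rw [sizeLev_q_eq M hn hr]
  exact Finset.card_image_of_injective _ Finset.coe_injective

/-! ## Boolean LYM for the up-set -/

open scoped Classical in
/-- **Every member of `U_k` lies below at least `n − k` members of `U_{k+1}`**: the sets `A ∪ {x}`, `x ∈ E ∖ A`. -/
lemma card_bipartiteAbove_sizeLev_ge {p q k : ℕ} {A : Set α} (hA : A ∈ sizeLev M p q k) :
    (gr M).card - k ≤ ((sizeLev M p q (k + 1)).bipartiteAbove (fun A A' => A ⊆ A') A).card := by
  classical
  obtain ⟨hAE, hAk, B, hB, hBA⟩ := (mem_sizeLev M).1 hA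
  have hfin : A.Finite := M.ground_finite.subset hAE
  set D : Finset α := gr M \ hfin.toFinset with hD
  have hDcard : D.card = (gr M).card - k := by
    rw [hD, Finset.card_sdiff_of_subset (fun x hx => ?_), ← Set.ncard_eq_toFinset_card A hfin, hAk]
    rw [Set.Finite.mem_toFinset] at hx
    exact (mem_gr M).2 (hAE hx)
  have hmemD : ∀ x, x ∈ D ↔ x ∈ M.E ∧ x ∉ A := by
    intro x
    rw [hD, Finset.mem_sdiff, Set.Finite.mem_toFinset, mem_gr]
  have hinj : Set.InjOn (fun x => insert x A) (D : Set α) := by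
    intro x hx y hy hxy
    rw [Finset.mem_coe, hmemD] at hx hy
    simp only at hxy
    have : x ∈ insert y A := by rw [← hxy]; exact Set.mem_insert _ _
    rcases this with h | h
    · exact h
    · exact absurd h hx.2
  have hmaps : ∀ x ∈ D, insert x A ∈ (sizeLev M p q (k + 1)).bipartiteAbove (fun A A' => A ⊆ A') A := by
    intro x hx
    rw [hmemD] at hx
    rw [Finset.bipartiteAbove, Finset.mem_filter, mem_sizeLev]
    refine ⟨⟨Set.insert_subset hx.1 hAE, ?_, B, hB, hBA.trans (Set.subset_insert _ _)⟩, Set.subset_insert _ _⟩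
    rw [Set.ncard_insert_of_notMem hx.2 hfin, hAk]
  rw [← hDcard, ← Finset.card_image_of_injOn hinj]
  exact Finset.card_le_card (fun A' hA' => by
    obtain ⟨x, hx, rfl⟩ := Finset.mem_image.1 hA'
    exact hmaps x hx)

open scoped Classical in
/-- **Every member of `U_{k+1}` lies above at most `k + 1` members of `U_k`**: its `k`-subsets. -/
lemma card_bipartiteBelow_sizeLev_le {p q k : ℕ} {A' : Set α} (hA' : A' ∈ sizeLev M p q (k + 1)) :
    ((sizeLev M p q k).bipartiteBelow (fun A A' => A ⊆ A') A').card ≤ k + 1 := by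
  classical
  obtain ⟨hA'E, hA'k, -⟩ := (mem_sizeLev M).1 hA'
  have hfin : A'.Finite := M.ground_finite.subset hA'E
  have hsub : (((sizeLev M p q k).bipartiteBelow (fun A A' => A ⊆ A') A' : Finset (Set α)) : Set (Set α))
      ⊆ {t | t ⊆ A' ∧ t.ncard = k} := by
    intro A hA
    rw [Finset.mem_coe, Finset.bipartiteBelow, Finset.mem_filter, mem_sizeLev] at hA
    exact ⟨hA.2, hA.1.2.1⟩
  have h1 := Set.ncard_le_ncard hsub (hfin.finite_subsets.subset (fun t ht => ht.1))
  rw [Set.ncard_coe_finset] at h1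
  have h2 := Set.ncard_powerset_ncard hfin k
  rw [hA'k, Nat.choose_succ_self_right] at h2
  rw [← h2]
  exact h1

/-- **Boolean LYM for the up-set of the bottom sets**: `U_k·(n − k) ≤ U_{k+1}·(k + 1)`. -/
theorem card_sizeLev_mul_le (p q k : ℕ) :
    (sizeLev M p q k).card * ((gr M).card - k) ≤ (sizeLev M p q (k + 1)).card * (k + 1) := by
  classical
  exact Finset.card_mul_le_card_mul (fun A A' => A ⊆ A') (fun A hA => card_bipartiteAbove_sizeLev_ge M hA)
    (fun A' hA' => card_bipartiteBelow_sizeLev_le M hA')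

/-- **The density of the up-set is nondecreasing**: `U_a·C(n, b) ≤ U_b·C(n, a)` for `a ≤ b`. -/
theorem card_sizeLev_mul_choose_le (p q : ℕ) {a b : ℕ} (hab : a ≤ b) :
    (sizeLev M p q a).card * ((gr M).card).choose b ≤ (sizeLev M p q b).card * ((gr M).card).choose a := by
  induction b, hab using Nat.le_induction with
  | base => exact le_rfl
  | succ k hak ih =>
    set n := (gr M).card with hn
    have hstep := card_sizeLev_mul_le M p q k
    have hid : n.choose (k + 1) * (k + 1) = n.choose k * (n - k) := Nat.choose_succ_right_eq n k
    have h3 : (sizeLev M p q a).card * n.choose (k + 1) * (k + 1)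
        ≤ (sizeLev M p q (k + 1)).card * n.choose a * (k + 1) := by
      calc (sizeLev M p q a).card * n.choose (k + 1) * (k + 1)
          = (sizeLev M p q a).card * n.choose k * (n - k) := by rw [mul_assoc, hid, mul_assoc]
        _ ≤ (sizeLev M p q k).card * n.choose a * (n - k) := Nat.mul_le_mul_right _ ih
        _ = (sizeLev M p q k).card * (n - k) * n.choose a := by ring
        _ ≤ (sizeLev M p q (k + 1)).card * (k + 1) * n.choose a := Nat.mul_le_mul_right _ hstep
        _ = (sizeLev M p q (k + 1)).card * n.choose a * (k + 1) := by ring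
    exact Nat.le_of_mul_le_mul_right h3 (Nat.succ_pos k)

/-! ## THEOREM P: the rank level dominates the size level below `p/2` -/

open scoped Classical in
/-- `L_ν`: the members of `U_u` of nullity `ν` (rank `u − ν`). -/
noncomputable def sizeLevNull (p q u ν : ℕ) : Finset (Set α) :=
  (sizeLev M p q u).filter (fun A => rk M A + ν = u)

open scoped Classical in
/-- `R_ν`: the members of `∂_u 𝓑` with `u + ν` elements (nullity `ν`). -/
noncomputable def shadowLevNull (p q u ν : ℕ) : Finset (Set α) :=
  (shadowLev M u (PerFlat.Uq M p q)).filter (fun A => A.ncard = u + ν)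

open scoped Classical in
/-- Membership in `sizeLevNull`. -/
lemma mem_sizeLevNull {p q u ν : ℕ} {A : Set α} :
    A ∈ sizeLevNull M p q u ν ↔ A ∈ sizeLev M p q u ∧ rk M A + ν = u := by
  unfold sizeLevNull
  rw [Finset.mem_filter]

open scoped Classical in
/-- Membership in `shadowLevNull`. -/
lemma mem_shadowLevNull {p q u ν : ℕ} {A : Set α} :
    A ∈ shadowLevNull M p q u ν ↔ A ∈ shadowLev M u (PerFlat.Uq M p q) ∧ A.ncard = u + ν := by
  unfold shadowLevNull
  rw [Finset.mem_filter]

omit [DecidableEq α] in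
/-- The natural rank of a subset of `E` equals the cardinality of any basis of it. -/
lemma rk_eq_ncard_of_isBasis {A I : Set α} (hA : A ⊆ M.E) (hI : M.IsBasis I A) : rk M A = I.ncard := by
  have hfin : I.Finite := M.ground_finite.subset (hI.subset.trans hA)
  have h := hI.eRk_eq_encard
  rw [eRk_eq_coe_rk M hA, ← hfin.cast_ncard_eq] at h
  exact_mod_cast h

open scoped Classical in
/-- **Every `A ∈ L_ν` lies below at least `C(p − u + ν, ν)` members of `R_ν`** (tight layer, `ν ≤ u`): take a
basis `I₀` of `A`, a base `β ⊇ I₀`; then `β ∖ A` has `p − u + ν` elements and `A ∪ X ∈ R_ν` for every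
`ν`-subset `X` of it. -/
lemma card_bipartiteAbove_shadowLevNull_ge {p q u ν : ℕ} (hr : M.eRank = (p : ℕ∞)) (hνu : ν ≤ u)
    (hup : u ≤ p) {A : Set α} (hA : A ∈ sizeLevNull M p q u ν) :
    (p - u + ν).choose ν ≤ ((shadowLevNull M p q u ν).bipartiteAbove (fun A A' => A ⊆ A') A).card := by
  classical
  obtain ⟨hA, hrk⟩ := (mem_sizeLevNull M).1 hA
  obtain ⟨hAE, hAu, B, hB, hBA⟩ := (mem_sizeLev M).1 hA
  have hfinA : A.Finite := M.ground_finite.subset hAE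
  obtain ⟨I₀, hI₀⟩ := M.exists_isBasis A hAE
  obtain ⟨β, hβ, hI₀β⟩ := hI₀.indep.exists_isBase_superset
  have hβE : β ⊆ M.E := hβ.subset_ground
  have hfinβ : β.Finite := M.ground_finite.subset hβE
  have hI₀card : I₀.ncard = u - ν := by
    rw [← rk_eq_ncard_of_isBasis M hAE hI₀]; omega
  have hβcard : β.ncard = p := by
    have h := hβ.encard_eq_eRank
    rw [hr, ← hfinβ.cast_ncard_eq] at h
    exact_mod_cast h
  -- `β ∩ A` is an independent subset of `A` containing `I₀`, hence has `u − ν` elements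
  have hβA : (β ∩ A).ncard = u - ν := by
    have h1 : I₀ ⊆ β ∩ A := Set.subset_inter hI₀β hI₀.subset
    have h2 : (β ∩ A).ncard ≤ u - ν := by
      have h := (hβ.indep.subset (Set.inter_subset_left (s := β) (t := A))).encard_le_eRk_of_subset
        (Set.inter_subset_right (s := β) (t := A))
      rw [eRk_eq_coe_rk M hAE, ← (hfinβ.subset Set.inter_subset_left).cast_ncard_eq] at h
      have h' : (β ∩ A).ncard ≤ rk M A := by exact_mod_cast h
      omega
    have h3 : u - ν ≤ (β ∩ A).ncard := by
      rw [← hI₀card]; exact Set.ncard_le_ncard h1 (hfinβ.subset Set.inter_subset_left)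
    omega
  set J : Set α := β \ A with hJ
  have hJcard : J.ncard = p - u + ν := by
    rw [hJ]
    have h := Set.ncard_inter_add_ncard_sdiff_eq_ncard β A hfinβ
    rw [hβA, hβcard] at h
    omega
  have hfinJ : J.Finite := hfinβ.subset Set.sdiff_subset
  -- every `ν`-subset `X` of `J` gives `A ∪ X ∈ R_ν` above `A`
  have hmaps : ∀ X ∈ {X | X ⊆ J ∧ X.ncard = ν},
      A ∪ X ∈ (((shadowLevNull M p q u ν).bipartiteAbove (fun A A' => A ⊆ A') A : Finset (Set α)) :
        Set (Set α)) := by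
    intro X hX
    obtain ⟨hXJ, hXν⟩ := hX
    have hXA : Disjoint X A := Set.disjoint_of_subset_left hXJ Set.disjoint_sdiff_left
    have hXβ : X ⊆ β := hXJ.trans Set.sdiff_subset
    have hXE : X ⊆ M.E := hXβ.trans hβE
    have hfinX : X.Finite := hfinJ.subset hXJ
    rw [Finset.mem_coe, Finset.bipartiteAbove, Finset.mem_filter, mem_shadowLevNull, mem_shadowLev]
    refine ⟨⟨⟨Set.union_subset hAE hXE, ?_, B, hB, hBA.trans Set.subset_union_left⟩, ?_⟩,
      Set.subset_union_left⟩
    · -- the rank of `A ∪ X` is `u`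
      have hle : M.eRk (A ∪ X) ≤ (u : ℕ∞) := by
        calc M.eRk (A ∪ X) ≤ M.eRk A + M.eRk X := M.eRk_union_le_eRk_add_eRk A X
          _ ≤ M.eRk A + X.encard := by gcongr; exact M.eRk_le_encard X
          _ = (u : ℕ∞) := by
            rw [eRk_eq_coe_rk M hAE, ← hfinX.cast_ncard_eq, hXν]
            exact_mod_cast hrk
      have hge : (u : ℕ∞) ≤ M.eRk (A ∪ X) := by
        have hind : M.Indep (I₀ ∪ X) := hβ.indep.subset (Set.union_subset hI₀β hXβ)
        have hdisj : Disjoint I₀ X := Set.disjoint_of_subset_left hI₀.subset hXA.symm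
        have h := hind.encard_le_eRk_of_subset (Set.union_subset_union_left X hI₀.subset)
        rw [Set.encard_union_eq hdisj, ← (hfinA.subset hI₀.subset).cast_ncard_eq, ← hfinX.cast_ncard_eq,
          hI₀card, hXν] at h
        have h' : ((u - ν + ν : ℕ) : ℕ∞) ≤ M.eRk (A ∪ X) := by exact_mod_cast h
        rwa [Nat.sub_add_cancel hνu] at h'
      have h := le_antisymm hle hge
      rw [eRk_eq_coe_rk M (Set.union_subset hAE hXE)] at h
      exact_mod_cast h
    · rw [Set.ncard_union_eq hXA.symm hfinA hfinX, hAu, hXν]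
  have hinj : Set.InjOn (fun X => A ∪ X) {X | X ⊆ J ∧ X.ncard = ν} := by
    intro X hX Y hY hXY
    have hXA : Disjoint X A := Set.disjoint_of_subset_left hX.1 Set.disjoint_sdiff_left
    have hYA : Disjoint Y A := Set.disjoint_of_subset_left hY.1 Set.disjoint_sdiff_left
    have h1 : (A ∪ X) \ A = (A ∪ Y) \ A := by simp only at hXY; rw [hXY]
    rwa [Set.union_sdiff_left, Set.union_sdiff_left, hXA.sdiff_eq_left, hYA.sdiff_eq_left] at h1
  have h := Set.ncard_le_ncard_of_injOn (fun X => A ∪ X) hmaps hinj (Finset.finite_toSet _)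
  rwa [Set.ncard_powerset_ncard hfinJ ν, hJcard, Set.ncard_coe_finset] at h

open scoped Classical in
/-- **Every `A' ∈ R_ν` lies above at most `C(u + ν, ν)` members of `L_ν`**: its `u`-subsets. -/
lemma card_bipartiteBelow_sizeLevNull_le {p q u ν : ℕ} {A' : Set α} (hA' : A' ∈ shadowLevNull M p q u ν) :
    ((sizeLevNull M p q u ν).bipartiteBelow (fun A A' => A ⊆ A') A').card ≤ (u + ν).choose ν := by
  classical
  obtain ⟨hA', hA'card⟩ := (mem_shadowLevNull M).1 hA'
  obtain ⟨hA'E, -, -⟩ := (mem_shadowLev M).1 hA'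
  have hfin : A'.Finite := M.ground_finite.subset hA'E
  have hsub : (((sizeLevNull M p q u ν).bipartiteBelow (fun A A' => A ⊆ A') A' : Finset (Set α)) :
      Set (Set α)) ⊆ {t | t ⊆ A' ∧ t.ncard = u} := by
    intro A hA
    rw [Finset.mem_coe, Finset.bipartiteBelow, Finset.mem_filter, mem_sizeLevNull, mem_sizeLev] at hA
    exact ⟨hA.2, hA.1.1.2.1⟩
  have h1 := Set.ncard_le_ncard hsub (hfin.finite_subsets.subset (fun t ht => ht.1))
  rw [Set.ncard_coe_finset] at h1
  have h2 := Set.ncard_powerset_ncard hfin u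
  rw [hA'card, Nat.choose_symm_add] at h2
  rw [← h2]
  exact h1

/-- **THEOREM P, stratified**: `|L_ν| ≤ |R_ν|` for `ν ≤ u` and `2u ≤ p` (tight layer). -/
theorem card_sizeLevNull_le_card_shadowLevNull {p q u ν : ℕ} (hr : M.eRank = (p : ℕ∞)) (hνu : ν ≤ u)
    (hu : 2 * u ≤ p) :
    (sizeLevNull M p q u ν).card ≤ (shadowLevNull M p q u ν).card := by
  classical
  have hdc := Finset.card_mul_le_card_mul (s := sizeLevNull M p q u ν) (t := shadowLevNull M p q u ν)
    (fun A A' => A ⊆ A') (fun A hA => card_bipartiteAbove_shadowLevNull_ge M hr hνu (by omega) hA)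
    (fun A' hA' => card_bipartiteBelow_sizeLevNull_le M hA')
  have hch : (u + ν).choose ν ≤ (p - u + ν).choose ν := Nat.choose_le_choose ν (by omega)
  have hpos : 0 < (p - u + ν).choose ν := Nat.choose_pos (by omega)
  have h : (sizeLevNull M p q u ν).card * (p - u + ν).choose ν
      ≤ (shadowLevNull M p q u ν).card * (p - u + ν).choose ν :=
    hdc.trans (Nat.mul_le_mul_left _ hch)
  exact Nat.le_of_mul_le_mul_right h hpos

/-- `U_u` is the disjoint union of the `L_ν`, `ν ≤ u`. -/
lemma card_sizeLev_eq_sum (p q u : ℕ) :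
    (sizeLev M p q u).card = ∑ ν ∈ Finset.range (u + 1), (sizeLevNull M p q u ν).card := by
  classical
  rw [Finset.card_eq_sum_card_fiberwise (f := fun A => u - rk M A) (t := Finset.range (u + 1))]
  · refine Finset.sum_congr rfl fun ν hν => ?_
    rw [Finset.mem_range] at hν
    congr 1
    ext A
    rw [mem_sizeLevNull, Finset.mem_filter]
    constructor
    · rintro ⟨hA, h⟩
      refine ⟨hA, ?_⟩
      have : rk M A ≤ u := by
        obtain ⟨hAE, hAu, -⟩ := (mem_sizeLev M).1 hA
        rw [← hAu]; exact rk_le_ncard M hAE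
      omega
    · rintro ⟨hA, h⟩
      exact ⟨hA, by omega⟩
  · intro A hA
    rw [Finset.mem_coe] at hA
    simp only [Finset.mem_coe, Finset.mem_range]
    have : rk M A ≤ u := by
      obtain ⟨hAE, hAu, -⟩ := (mem_sizeLev M).1 hA
      rw [← hAu]; exact rk_le_ncard M hAE
    omega

/-- The `R_ν` are pairwise disjoint subfamilies of `∂_u 𝓑`, so their total is at most `s_u`. -/
lemma sum_card_shadowLevNull_le (p q u : ℕ) (t : Finset ℕ) :
    ∑ ν ∈ t, (shadowLevNull M p q u ν).card ≤ (shadowLev M u (PerFlat.Uq M p q)).card := by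
  classical
  rw [← Finset.card_biUnion]
  · exact Finset.card_le_card (Finset.biUnion_subset.2 fun ν _ => Finset.filter_subset _ _)
  · intro ν₁ _ ν₂ _ hne
    rw [Function.onFun, Finset.disjoint_left]
    intro A h1 h2
    rw [mem_shadowLevNull] at h1 h2
    exact hne (by omega)

/-- **THEOREM P**: on the tight layer the rank level dominates the size level below `p/2`:
`U_u ≤ s_u` for `q ≤ u` with `2u ≤ p`. -/
theorem card_sizeLev_le_card_shadowLev {p q u : ℕ} (hr : M.eRank = (p : ℕ∞)) (hu : 2 * u ≤ p) :
    (sizeLev M p q u).card ≤ (shadowLev M u (PerFlat.Uq M p q)).card := by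
  rw [card_sizeLev_eq_sum]
  refine (Finset.sum_le_sum fun ν hν => ?_).trans (sum_card_shadowLevNull_le M p q u _)
  rw [Finset.mem_range] at hν
  exact card_sizeLevNull_le_card_shadowLevNull M hr (by omega) hu

/-! ## Consequences for the row C-048 -/

/-- **The weak cumulative inequality below `p/2`**: `#𝓑·C(p+q, u) ≤ s_u·C(p+q, q)` for `q ≤ u ≤ p/2`. -/
theorem card_Uq_mul_choose_le_card_shadowLev_mul_choose {p q u : ℕ} (hn : (gr M).card = p + q)
    (hr : M.eRank = (p : ℕ∞)) (hqu : q ≤ u) (hu : 2 * u ≤ p) :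
    (PerFlat.Uq M p q).card * (p + q).choose u ≤ (shadowLev M u (PerFlat.Uq M p q)).card * (p + q).choose q := by
  have h1 := card_sizeLev_mul_choose_le M p q hqu
  rw [hn, card_sizeLev_q M hn hr] at h1
  exact h1.trans (Nat.mul_le_mul_right _ (card_sizeLev_le_card_shadowLev M hr hu))

/-- With closed bottom sets every rank-`q` shadow set IS a bottom set: `∂_q 𝓑 ⊆ 𝓑`. -/
lemma shadowLev_q_subset_of_closed {p q : ℕ} (hn : (gr M).card = p + q) (hr : M.eRank = (p : ℕ∞))
    (hcl : ∀ B ∈ PerFlat.Uq M p q, M.closure (B : Set α) = B) :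
    shadowLev M q (PerFlat.Uq M p q) ⊆ (PerFlat.Uq M p q).image (fun B : Finset α => (B : Set α)) := by
  intro A hA
  obtain ⟨-, -, B, hB, hBA⟩ := (mem_shadowLev M).1 hA
  have hsub := subset_closure_of_mem_shadowLev_q M hn hr hA hB hBA
  rw [hcl B hB] at hsub
  rw [Finset.mem_image]
  exact ⟨B, hB, (Set.Subset.antisymm hsub hBA).symm⟩

/-- With closed bottom sets `s_q ≤ #𝓑` (in fact `s_q = #𝓑`). -/
lemma card_shadowLev_q_le_of_closed {p q : ℕ} (hn : (gr M).card = p + q) (hr : M.eRank = (p : ℕ∞))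
    (hcl : ∀ B ∈ PerFlat.Uq M p q, M.closure (B : Set α) = B) :
    (shadowLev M q (PerFlat.Uq M p q)).card ≤ (PerFlat.Uq M p q).card :=
  (Finset.card_le_card (shadowLev_q_subset_of_closed M hn hr hcl)).trans Finset.card_image_le

/-- **C-048 below `p/2` with closed bottom sets**: if every bottom set is closed then
`s_q·C(p+q, u) ≤ s_u·C(p+q, q)` for every `q ≤ u ≤ p/2`. -/
theorem shadowCumulative_below_half_of_closed {p q u : ℕ} (hn : (gr M).card = p + q)
    (hr : M.eRank = (p : ℕ∞)) (hcl : ∀ B ∈ PerFlat.Uq M p q, M.closure (B : Set α) = B) (hqu : q ≤ u)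
    (hu : 2 * u ≤ p) :
    (shadowLev M q (PerFlat.Uq M p q)).card * (p + q).choose u
      ≤ (shadowLev M u (PerFlat.Uq M p q)).card * (p + q).choose q :=
  (Nat.mul_le_mul_right _ (card_shadowLev_q_le_of_closed M hn hr hcl)).trans
    (card_Uq_mul_choose_le_card_shadowLev_mul_choose M hn hr hqu hu)

/-- **C-048 below `p/2` when every circuit has at least `q + 2` elements.** -/
theorem shadowCumulative_below_half_of_circuits {p q u : ℕ} (hn : (gr M).card = p + q)
    (hr : M.eRank = (p : ℕ∞)) (hg : ∀ C, M.IsCircuit C → ((q + 2 : ℕ) : ℕ∞) ≤ C.encard) (hqu : q ≤ u)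
    (hu : 2 * u ≤ p) :
    (shadowLev M q (PerFlat.Uq M p q)).card * (p + q).choose u
      ≤ (shadowLev M u (PerFlat.Uq M p q)).card * (p + q).choose q :=
  shadowCumulative_below_half_of_closed M hn hr (closure_Uq_eq_self_of_circuits M hn hr hg) hqu hu

end PercRepro.RankDist
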